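/-
HONEST FRAMING: certified error envelopes and provably optimal rounding/accumulation schemes for
low-precision formats under stated cost models; every table by two implementations; no hardware
or vendor claims.
-/
import Mathlib.Data.Rat.Defs
import Mathlib.Algebra.Order.Field.Basic
import Mathlib.Algebra.BigOperators.Group.List.Basic
import Mathlib.Tactic.Linarith
import Mathlib.Tactic.Ring
import Mathlib.Tactic.Positivity

/-!
# The demotion law (Theorem T8), part 9a: integer coefficient vectors for cone certificates

Kernel-friendly linear algebra for the CONE-CLOSURE CERTIFICATES of opt gen 14 (C36/C37: Conjecture
D for every tree at `q = 4, 5`): a linear functional on a table `v : ℕ → ℚ` is a list of integer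
coefficients (`dot r v = Σ_i r_i · v_i`, missing entries read as `0`), with padded addition `addV`,
scaling `smulV`, unit vectors `unitV`, the componentwise test `leV` (sound on nonnegative tables:
`dot_le_of_leV`), the positive-multiple test `posMultV` (`dot_nonpos_of_posMultV`), and the
positive / negative parts `dotPos` / `dotNeg` of a functional.  Part 9b (`OptDemotionRoutingCone`)
builds the certificate checker on these; everything here is `List ℤ` / structural recursion so that
`decide +kernel` evaluates it.
-/

namespace Summit.Ventures.CertifiedArithmetic.LowPrec.Opt.Cone

/-! ## Functionals as integer coefficient lists -/

/-- `dot r v = Σ_{i < |r|} r_i · v_i`. -/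
def dot : List ℤ → (ℕ → ℚ) → ℚ
  | [], _ => 0
  | c :: cs, v => (c : ℚ) * v 0 + dot cs (fun i => v (i + 1))

/-- `dot [] v = 0`. -/
@[simp] theorem dot_nil (v : ℕ → ℚ) : dot [] v = 0 := rfl

/-- `dot (c :: cs) v = c v₀ + dot cs (v ∘ succ)`. -/
@[simp] theorem dot_cons (c : ℤ) (cs : List ℤ) (v : ℕ → ℚ) :
    dot (c :: cs) v = (c : ℚ) * v 0 + dot cs (fun i => v (i + 1)) := rfl

/-- Padded addition of coefficient lists. -/
def addV : List ℤ → List ℤ → List ℤ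
  | [], ys => ys
  | x :: xs, [] => x :: xs
  | x :: xs, y :: ys => (x + y) :: addV xs ys

/-- Scaling of a coefficient list. -/
def smulV (c : ℤ) (xs : List ℤ) : List ℤ := xs.map fun x => c * x

/-- The unit functional `c · v_i`. -/
def unitV (i : ℕ) (c : ℤ) : List ℤ := List.replicate i 0 ++ [c]

/-- `dot` is additive in the coefficient list. -/
theorem dot_addV : ∀ (xs ys : List ℤ) (v : ℕ → ℚ), dot (addV xs ys) v = dot xs v + dot ys v
  | [], ys, v => by simp [addV]
  | x :: xs, [], v => by simp [addV]
  | x :: xs, y :: ys, v => by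
      simp only [addV, dot_cons, Int.cast_add]
      rw [dot_addV xs ys]
      ring

/-- `dot` is homogeneous in the coefficient list. -/
theorem dot_smulV (c : ℤ) : ∀ (xs : List ℤ) (v : ℕ → ℚ), dot (smulV c xs) v = (c : ℚ) * dot xs v
  | [], v => by simp [smulV]
  | x :: xs, v => by
      have ih := dot_smulV c xs (fun i => v (i + 1))
      simp only [smulV, List.map_cons, dot_cons, Int.cast_mul] at ih ⊢
      rw [ih]
      ring

/-- A list of zeros scores nothing. -/
theorem dot_replicate_zero : ∀ (i : ℕ) (v : ℕ → ℚ), dot (List.replicate i 0) v = 0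
  | 0, v => by simp
  | i + 1, v => by
      rw [List.replicate_succ, dot_cons, dot_replicate_zero i]
      simp

/-- The unit functional reads one entry. -/
theorem dot_unitV : ∀ (i : ℕ) (c : ℤ) (v : ℕ → ℚ), dot (unitV i c) v = (c : ℚ) * v i
  | 0, c, v => by simp [unitV]
  | i + 1, c, v => by
      have ih := dot_unitV i c (fun j => v (j + 1))
      simp only [unitV] at ih ⊢
      rw [List.replicate_succ, List.cons_append, dot_cons, ih]
      simp

/-- `dot` is additive in the table. -/
theorem dot_add_fun : ∀ (r : List ℤ) (x y : ℕ → ℚ),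
    dot r (fun i => x i + y i) = dot r x + dot r y
  | [], x, y => by simp
  | c :: cs, x, y => by
      simp only [dot_cons]
      rw [dot_add_fun cs]
      ring

/-- `dot` is homogeneous in the table. -/
theorem dot_mul_fun (a : ℚ) : ∀ (r : List ℤ) (x : ℕ → ℚ), dot r (fun i => a * x i) = a * dot r x
  | [], x => by simp
  | c :: cs, x => by
      simp only [dot_cons]
      rw [dot_mul_fun a cs]
      ring

/-- `dot` on a constant table is the coefficient sum. -/
theorem dot_const (a : ℚ) : ∀ (r : List ℤ), dot r (fun _ => a) = a * ((r.sum : ℤ) : ℚ)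
  | [] => by simp
  | c :: cs => by
      simp only [dot_cons, List.sum_cons, Int.cast_add]
      rw [dot_const a cs]
      ring

/-- `dot r` only reads the first `|r|` entries. -/
theorem dot_congr : ∀ (r : List ℤ) {x y : ℕ → ℚ}, (∀ i, i < r.length → x i = y i) → dot r x = dot r y
  | [], _, _, _ => by simp
  | c :: cs, x, y, h => by
      simp only [dot_cons]
      rw [h 0 (by simp), dot_congr cs (x := fun i => x (i + 1)) (y := fun i => y (i + 1))
        fun i hi => h (i + 1) (by simpa using hi)]

/-- Nonnegative coefficients on a nonnegative table score `≥ 0`. -/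
theorem dot_nonneg_of_all : ∀ (ys : List ℤ) (v : ℕ → ℚ), (ys.all fun y => decide (0 ≤ y)) = true →
    (∀ i, 0 ≤ v i) → 0 ≤ dot ys v
  | [], v, _, _ => by simp
  | y :: ys, v, h, hv => by
      simp only [List.all_cons, Bool.and_eq_true, decide_eq_true_eq] at h
      rw [dot_cons]
      have h1 : (0 : ℚ) ≤ (y : ℚ) * v 0 := mul_nonneg (by exact_mod_cast h.1) (hv 0)
      have h2 := dot_nonneg_of_all ys (fun i => v (i + 1)) h.2 fun i => hv (i + 1)
      linarith

/-- Nonpositive coefficients on a nonnegative table score `≤ 0`. -/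
theorem dot_nonpos_of_all : ∀ (xs : List ℤ) (v : ℕ → ℚ), (xs.all fun x => decide (x ≤ 0)) = true →
    (∀ i, 0 ≤ v i) → dot xs v ≤ 0
  | [], v, _, _ => by simp
  | x :: xs, v, h, hv => by
      simp only [List.all_cons, Bool.and_eq_true, decide_eq_true_eq] at h
      rw [dot_cons]
      have h1 : (x : ℚ) * v 0 ≤ 0 := mul_nonpos_of_nonpos_of_nonneg (by exact_mod_cast h.1) (hv 0)
      have h2 := dot_nonpos_of_all xs (fun i => v (i + 1)) h.2 fun i => hv (i + 1)
      linarith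

/-! ## The componentwise test -/

/-- `leV xs ys`: `xs ≤ ys` componentwise, missing entries read as `0`. -/
def leV : List ℤ → List ℤ → Bool
  | [], ys => ys.all fun y => decide (0 ≤ y)
  | x :: xs, [] => (x :: xs).all fun x => decide (x ≤ 0)
  | x :: xs, y :: ys => decide (x ≤ y) && leV xs ys

/-- SOUNDNESS of `leV` on nonnegative tables. -/
theorem dot_le_of_leV : ∀ (xs ys : List ℤ) (v : ℕ → ℚ), leV xs ys = true → (∀ i, 0 ≤ v i) →
    dot xs v ≤ dot ys v
  | [], ys, v, h, hv => by
      rw [dot_nil]; exact dot_nonneg_of_all ys v h hv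
  | x :: xs, [], v, h, hv => by
      rw [dot_nil]; exact dot_nonpos_of_all (x :: xs) v h hv
  | x :: xs, y :: ys, v, h, hv => by
      simp only [leV, Bool.and_eq_true, decide_eq_true_eq] at h
      rw [dot_cons, dot_cons]
      have h1 : (x : ℚ) * v 0 ≤ (y : ℚ) * v 0 :=
        mul_le_mul_of_nonneg_right (by exact_mod_cast h.1) (hv 0)
      have h2 := dot_le_of_leV xs ys (fun i => v (i + 1)) h.2 fun i => hv (i + 1)
      linarith

/-! ## The positive-multiple test -/

/-- `propV xs ys a b`: `b · xs = a · ys` componentwise (missing entries read as `0`). -/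
def propV : List ℤ → List ℤ → ℤ → ℤ → Bool
  | [], ys, a, _ => ys.all fun y => decide (a * y = 0)
  | x :: xs, [], _, b => (x :: xs).all fun x => decide (b * x = 0)
  | x :: xs, y :: ys, a, b => decide (b * x = a * y) && propV xs ys a b

/-- Soundness of `propV`: `b · dot xs = a · dot ys`. -/
theorem dot_propV : ∀ (xs ys : List ℤ) (a b : ℤ) (v : ℕ → ℚ), propV xs ys a b = true →
    (b : ℚ) * dot xs v = (a : ℚ) * dot ys v
  | [], ys, a, b, v, h => by
      rw [dot_nil, mul_zero]
      induction ys generalizing v with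
      | nil => simp
      | cons y ys ih =>
          simp only [propV, List.all_cons, Bool.and_eq_true, decide_eq_true_eq] at h ih
          rw [dot_cons, mul_add, ← mul_assoc, ← ih (fun i => v (i + 1)) h.2]
          have : (a : ℚ) * (y : ℚ) = 0 := by exact_mod_cast h.1
          simp [this]
  | x :: xs, [], a, b, v, h => by
      rw [dot_nil, mul_zero]
      simp only [propV] at h
      have key : ∀ (zs : List ℤ) (w : ℕ → ℚ), (zs.all fun z => decide (b * z = 0)) = true →
          (b : ℚ) * dot zs w = 0 := by
        intro zs
        induction zs with
        | nil => intro w _; simp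
        | cons z zs ih =>
            intro w hz
            simp only [List.all_cons, Bool.and_eq_true, decide_eq_true_eq] at hz
            rw [dot_cons, mul_add, ← mul_assoc, ih (fun i => w (i + 1)) hz.2]
            have : (b : ℚ) * (z : ℚ) = 0 := by exact_mod_cast hz.1
            simp [this]
      exact key (x :: xs) v h
  | x :: xs, y :: ys, a, b, v, h => by
      simp only [propV, Bool.and_eq_true, decide_eq_true_eq] at h
      rw [dot_cons, dot_cons, mul_add, mul_add, ← mul_assoc, ← mul_assoc]
      have e1 : (b : ℚ) * (x : ℚ) = (a : ℚ) * (y : ℚ) := by exact_mod_cast h.1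
      rw [e1, dot_propV xs ys a b (fun i => v (i + 1)) h.2]

/-- The first nonzero entry of a list with its counterpart in the other list (`(x_i, y_i)` for the
least `i` with `y_i ≠ 0`; `(0, 0)` if none). -/
def leadPair : List ℤ → List ℤ → ℤ × ℤ
  | _, [] => (0, 0)
  | [], y :: ys => if y = 0 then leadPair [] ys else (0, y)
  | x :: xs, y :: ys => if y = 0 then leadPair xs ys else (x, y)

/-- `posMultV r f`: `r` is a POSITIVE rational multiple of `f` (so `dot r v ≤ 0 → dot f v ≤ 0`). -/
def posMultV (r f : List ℤ) : Bool :=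
  let p := leadPair r f
  decide (0 < p.1 * p.2) && propV r f p.1 p.2

/-- SOUNDNESS of `posMultV`: a nonpositive functional has nonpositive positive submultiples. -/
theorem dot_nonpos_of_posMultV {r f : List ℤ} (h : posMultV r f = true) {v : ℕ → ℚ}
    (hr : dot r v ≤ 0) : dot f v ≤ 0 := by
  simp only [posMultV, Bool.and_eq_true, decide_eq_true_eq] at h
  obtain ⟨hpos, hprop⟩ := h
  set a := (leadPair r f).1 with ha
  set b := (leadPair r f).2 with hb
  have key := dot_propV r f a b v hprop
  -- `a` and `b` have the same strict sign
  rcases lt_trichotomy 0 a with ha0 | ha0 | ha0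
  · have hb0 : 0 < b := by
      by_contra hle; rw [not_lt] at hle
      have : a * b ≤ 0 := mul_nonpos_of_nonneg_of_nonpos ha0.le hle
      linarith
    have h1 : (a : ℚ) * dot f v = (b : ℚ) * dot r v := key.symm
    have h2 : (b : ℚ) * dot r v ≤ 0 := mul_nonpos_of_nonneg_of_nonpos (by exact_mod_cast hb0.le) hr
    have ha' : (0 : ℚ) < a := by exact_mod_cast ha0
    by_contra hcon; rw [not_le] at hcon
    have : 0 < (a : ℚ) * dot f v := mul_pos ha' hcon
    linarith
  · rw [← ha0, zero_mul] at hpos; exact absurd hpos (lt_irrefl 0)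
  · have hb0 : b < 0 := by
      by_contra hle; rw [not_lt] at hle
      have : a * b ≤ 0 := mul_nonpos_of_nonpos_of_nonneg ha0.le hle
      linarith
    have h1 : (a : ℚ) * dot f v = (b : ℚ) * dot r v := key.symm
    have h2 : 0 ≤ (b : ℚ) * dot r v := mul_nonneg_of_nonpos_of_nonpos (by exact_mod_cast hb0.le) hr
    have ha' : (a : ℚ) < 0 := by exact_mod_cast ha0
    by_contra hcon; rw [not_le] at hcon
    have : (a : ℚ) * dot f v < 0 := mul_neg_of_neg_of_pos ha' hcon
    linarith

/-! ## Positive and negative parts of a functional -/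

/-- The positive-coefficient part of `dot`. -/
def dotPos : List ℤ → (ℕ → ℚ) → ℚ
  | [], _ => 0
  | c :: cs, v => (if 0 < c then (c : ℚ) * v 0 else 0) + dotPos cs (fun i => v (i + 1))

/-- The negative-coefficient part of `dot`. -/
def dotNeg : List ℤ → (ℕ → ℚ) → ℚ
  | [], _ => 0
  | c :: cs, v => (if c < 0 then (c : ℚ) * v 0 else 0) + dotNeg cs (fun i => v (i + 1))

/-- `dot = dotPos + dotNeg`. -/
theorem dot_eq_dotPos_add_dotNeg : ∀ (r : List ℤ) (v : ℕ → ℚ), dot r v = dotPos r v + dotNeg r v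
  | [], v => by simp [dotPos, dotNeg]
  | c :: cs, v => by
      simp only [dot_cons, dotPos, dotNeg]
      rw [dot_eq_dotPos_add_dotNeg cs]
      rcases lt_trichotomy c 0 with hc | hc | hc
      · rw [if_neg (by omega), if_pos hc]; ring
      · subst hc; simp
      · rw [if_pos hc, if_neg (by omega)]; ring

/-- The absolute values of the negative coefficients (`0` elsewhere). -/
def negPart (r : List ℤ) : List ℤ := r.map fun c => if c < 0 then -c else 0

/-- `dotNeg r v = - dot (negPart r) v`. -/
theorem dotNeg_eq_neg_dot_negPart : ∀ (r : List ℤ) (v : ℕ → ℚ), dotNeg r v = - dot (negPart r) v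
  | [], v => by simp [dotNeg, negPart]
  | c :: cs, v => by
      have ih := dotNeg_eq_neg_dot_negPart cs (fun i => v (i + 1))
      simp only [dotNeg, negPart, List.map_cons, dot_cons] at ih ⊢
      rw [ih]
      by_cases hc : c < 0
      · rw [if_pos hc, if_pos hc]; push_cast; ring
      · rw [if_neg hc, if_neg hc]; push_cast; ring

/-- `dotPos []`. -/
@[simp] theorem dotPos_nil (v : ℕ → ℚ) : dotPos [] v = 0 := rfl

/-- `dotPos (c :: cs)`. -/
theorem dotPos_cons (c : ℤ) (cs : List ℤ) (v : ℕ → ℚ) :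
    dotPos (c :: cs) v = (if 0 < c then (c : ℚ) * v 0 else 0) + dotPos cs (fun i => v (i + 1)) := rfl

end Summit.Ventures.CertifiedArithmetic.LowPrec.Opt.Cone
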